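import Summits.NavierStokesRegularity.FunctionalMining.TopEigHeatDanskin
import Summits.NavierStokesRegularity.FunctionalMining.TopEigDanskinDensityUSC
import Summits.NavierStokesRegularity.FunctionalMining.TopEigProductionReverse
import HarnessLib

/-!
# No-go ledger, door (b) = (F2): LEVEL-WISE BALANCE LOCALISES — a universal design carries, on
every positive level of `λ₁`, a point whose Danskin mass does not melt; in particular a FROZEN TOP
(gen 50, touch 11)

Search for candidate a priori estimates; no regularity claim.

Context (door (b) of `NOGO.md` = the WANTED kernel fact `¬ TopEigHeatCoercivePos q`, `q > 1`). For a
smooth divergence-free design `v` write `λ₁ = torusStrainTopEig v ≥ 0`, `S = StrainL4.strainFlat`,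
and `μ(x) = dirTopEig (S v x) (S w x)` for the Danskin mass in a direction `w` (`w = Δv` for heat:
`μ(x) = max {eᵀ S(Δv)(x) e : e a unit top eigenvector of S(v)(x)}` is the right derivative at
`t = 0` of `t ↦ λ₁(v + tΔv)(x)`, `TopEig.hasDerivWithinAt_lam_line`). The cell's exactness analysis
so far: exactness of `Φ_q` at one exponent is ONE balanced tilted average `∫ λ₁^{q−1} μ = 0`
(staged K47 (R1)); the exact-exponent set of one design is isolated or all of `(1, ∞)` (staged K50
(R8)); "all" ⟺ LEVEL-WISE BALANCE `∫ φ(λ₁) μ = 0` for every continuous `φ` with `φ(0) = 0`, which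
forbids a STRICT SIGN of `μ` on any visited spectral window `{c < λ₁ < c'}` with `c ≥ 0` (staged
K51 (R9): `exists_nonexact_of_dirTopEig_pos_on_window` / `…_neg_on_window`). This file turns the
window statement into POINTS, using only the tree (`TopEigHeatDanskin`); the window hypotheses
below are literally the contrapositives of K51's two window theorems, so for a universal (or
band-exact, or integer-exact) design both hold with `w = Δv`.

## 1. Semicontinuity of the Danskin mass (tree) and its oddness at simple points of `T³`

The tree proves that `μ` is UPPER SEMICONTINUOUS in `(A, M)`
(`TopEig.dirTopEig_upperSemicontinuous`, an upper-hemicontinuous top eigen-set) and hence along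
smooth fields (`TopEig.upperSemicontinuous_dirTopEig_strainFlat`, `TopEigDanskinDensityUSC`, F1
PART I Remark (1d)); it is not continuous at crossings. Here: the opposite-direction mass
`x ↦ μ(S v x; −S w x)` is upper semicontinuous too (`upperSemicontinuous_dirTopEig_strainFlat_neg`),
dominates `−μ` (`TopEig.dirTopEig_add_dirTopEig_neg_nonneg`, tree), and AT A SIMPLE POINT of `T³`
(`λ₂(x) < λ₁(x)`, top eigen-set `{±e}`) the mass is odd: `μ(S v x; −M) = −μ(S v x; M)`
(`dirTopEig_strainFlat_neg_of_midEig_lt`, from the tree's gap form `TopEigSimpleGap`).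

## 2. Localisation on levels (pure topology)

On a compact space, if a continuous `lam` and an upper semicontinuous `μ` admit, for every `δ > 0`,
a point with `|lam − c| < δ` and `μ ≥ 0`, then some point has `lam = c` AND `μ ≥ 0`
(`exists_level_eq_of_forall_near`: minimise `|lam − c|` over the closed set `{μ ≥ 0}`).

## 3. Windows to levels

* `exists_level_point_dirTopEig_nonneg`: if NO visited window `{c < λ₁ < c'}` with `c ≥ 0` carries
  `μ < 0` throughout (K51's conclusion for universal designs), then on EVERY attained positive level
  `{λ₁ = λ₁(x₁)}`, `λ₁(x₁) > 0`, some point has `μ ≥ 0`;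
* `exists_level_point_dirTopEig_neg_nonneg`: the mirror statement — no window with `μ > 0`
  throughout ⇒ on every attained positive level a point with `dirTopEig (S v x) (−S w x) ≥ 0`, i.e.
  SOME top eigenvector `e` of `S(v)(x)` has `eᵀ S(w)(x) e ≤ 0` (min-convention; where `λ₁` is simple
  the two masses coincide);
* `exists_argmax_dirTopEig_nonneg`: in particular at the TOP level — some maximiser `x⋆` of `λ₁`
  has `μ(x⋆) ≥ 0`.
* on `T³`: `exists_level_point_nonpos_or_crossing` — no window with `μ > 0` throughout ⇒ every
  attained positive level carries a point with `μ ≤ 0` OR an eigenvalue CROSSING `λ₂ = λ₁`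
  (oddness at simple points); `exists_argmax_nonpos_or_crossing` at the top level.

## 4. Heat: a top that does not melt

`exists_frozen_top_of_noNegWindow` (`w = Δv`): under the no-negative-window hypothesis a smooth
design with `λ₁ ≢ 0` has a maximiser `x⋆` of `λ₁` at which the right derivative of
`t ↦ λ₁(v + tΔv)(x⋆)` at `t = 0` exists, equals `μ(x⋆)`, and is `≥ 0`: to first order the heat
flow does NOT lower the top strain eigenvalue at that global maximum.

## Meaning for the (F2) search (design rule, records only)

(R10) FROZEN TOP. A universal design — equivalently (K50/K51) one exact on a band or at every
integer exponent — has a global maximum point `x⋆` of `λ₁` where `max_{e top} eᵀ S(Δv)(x⋆) e ≥ 0`,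
and on every positive level of `λ₁` both a point with `μ ≥ 0` and a point with `min_{e top} eᵀ
S(Δv) e ≤ 0` — on `T³`: a point with `μ ≤ 0` or a crossing `λ₂ = λ₁` (typed). Pen remark (NOT
typed here): where the top eigenvalue is SIMPLE near a maximiser,
`λ₁` is smooth, `S(Δv) = Δ(S v)`, and Hadamard's second-order formula gives
`e₁ᵀ (ΔS) e₁ = Δλ₁ − 2 Σ_k Σ_{j≠1} (e_jᵀ ∂_k S e₁)² / (λ₁ − λ_j) ≤ Δλ₁ ≤ 0` at the maximum, with
equality only if `Δλ₁(x⋆) = 0` and `∂_k S e₁ ∥ e₁` for all `k`; so a frozen top is either an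
eigenvalue CROSSING `λ₁ = λ₂` at the maximum (K48's twin point (R4), now pinned AT THE TOP) or a
maximum that is degenerate to second order with frozen eigenvector transport. Generic smooth designs
have neither; by K50 their exact exponents (if any) are then ISOLATED.

HONEST CAVEAT. Structure only: no design is constructed and no branch is excluded; the statements
hold in every dimension and say nothing about constants on `T³`; the Hadamard remark is prose; the
window hypotheses are assumptions of this file (discharged for universal designs by the staged K51,
not importable here); no node of the ledger is decided; L-λ(q) remains OPEN for every real `q > 1`.
FILING (prove seat g29, REQUEST #78): declarations byte-identical to the no-go seat's staged `TopEigHeatFrozenTop.STAGING.lean` 2ce40e46b9dbab6d; this line is the only addition.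
-/

noncomputable section

open MeasureTheory Set Filter Topology Matrix

namespace Summit.NavierStokesRegularity.FunctionalMining

open Literature.Analysis.FunctionSpaces SharpClass.DirectorForm

namespace TopEig

variable {d : Type*} [Fintype d] [DecidableEq d] [Nonempty d]

/-! ## 1. Semicontinuity and oddness of the Danskin mass -/

variable {v w : UnitAddTorus d → EuclideanSpace ℝ d}

/-- The mass in the opposite direction, `x ↦ μ(S(v)(x); −S(w)(x))`, is upper semicontinuous for
smooth `v, w` (the tree's joint upper semicontinuity `TopEig.dirTopEig_upperSemicontinuous` along
the continuous pair `(S v, −S w)`); so the min-convention mass `−μ(S v; −S w)` is lower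
semicontinuous. [ours] -/
theorem upperSemicontinuous_dirTopEig_strainFlat_neg (hv : Torus.IsSmooth v)
    (hw : Torus.IsSmooth w) :
    UpperSemicontinuous fun x =>
      dirTopEig (StrainL4.strainFlat v x) (-StrainL4.strainFlat w x) := by
  have hg : Continuous fun x : UnitAddTorus d =>
      (StrainL4.strainFlat v x, -StrainL4.strainFlat w x) :=
    (StrainL4.continuous_strainFlat hv).prodMk (StrainL4.continuous_strainFlat hw).neg
  have h := (dirTopEig_upperSemicontinuous (d := d)).comp hg
  exact h

/-- **Oddness at a simple point of `T³`.** If `λ₂(x) < λ₁(x)` then the top eigen-set of `S(v)(x)`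
is `{±e}` (gap form, `TopEigSimpleGap`) and `μ(S v x; −M) = −μ(S v x; M)` for every direction
`M`: the max- and min-convention masses coincide. [ours] -/
theorem dirTopEig_strainFlat_neg_of_midEig_lt {u : UnitAddTorus (Fin 3) → EuclideanSpace ℝ (Fin 3)}
    {x : UnitAddTorus (Fin 3)} (hx : torusStrainMidEig u x < torusStrainTopEig u x)
    (M : EuclideanSpace ℝ (Fin 3 × Fin 3)) :
    dirTopEig (StrainL4.strainFlat u x) (-M) = -dirTopEig (StrainL4.strainFlat u x) M := by
  obtain ⟨e, he1, hSe, hg, hgap⟩ := exists_gapForm_of_midEig_lt_topEig hx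
  have he1' : e ∈ unitSphere (Fin 3) := he1
  have hgf := gapForm_of_eigenvector (torusStrainMatrix_isSymm u x) he1' hSe hgap
  have hquad : quad (flat (torusStrainMatrix u x)) e = torusStrainTopEig u x := by
    rw [quad_flat, hSe, dotProduct_smul, he1, smul_eq_mul, mul_one]
  have h1 := dirTopEig_eq_quad_of_gapForm he1' hg hgf hquad M
  have h2 := dirTopEig_eq_quad_of_gapForm he1' hg hgf hquad (-M)
  rw [flat_torusStrainMatrix] at h1 h2
  rw [h1, h2, ← neg_one_smul ℝ M, quad_smul]
  ring

/-! ## 2. Localisation on levels -/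

/-- **Level localisation (pure topology).** On a compact space let `lam` be continuous and `μ`
upper semicontinuous; if for every `δ > 0` some point has `|lam − c| < δ` and `μ ≥ 0`, then some
point has `lam = c` and `μ ≥ 0` (minimise `|lam − c|` over the closed, hence compact, set
`{μ ≥ 0}`). [folklore] -/
theorem exists_level_eq_of_forall_near {X : Type*} [TopologicalSpace X] [CompactSpace X]
    {lam μ : X → ℝ} (hlam : Continuous lam) (hμ : UpperSemicontinuous μ) {c : ℝ}
    (h : ∀ δ : ℝ, 0 < δ → ∃ x, |lam x - c| < δ ∧ 0 ≤ μ x) :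
    ∃ x, lam x = c ∧ 0 ≤ μ x := by
  have hFc : IsClosed {x | 0 ≤ μ x} := (upperSemicontinuous_iff_isClosed_preimage.1 hμ) 0
  have hFne : ({x | 0 ≤ μ x} : Set X).Nonempty := by
    obtain ⟨x, -, hx⟩ := h 1 one_pos
    exact ⟨x, hx⟩
  have hcont : ContinuousOn (fun x => |lam x - c|) {x | 0 ≤ μ x} :=
    (continuous_abs.comp (hlam.sub continuous_const)).continuousOn
  obtain ⟨x₀, hx₀F, hmin⟩ := hFc.isCompact.exists_isMinOn hFne hcont
  refine ⟨x₀, ?_, hx₀F⟩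
  by_contra hne
  have hpos : 0 < |lam x₀ - c| := abs_pos.2 (sub_ne_zero.2 hne)
  obtain ⟨x, hx, hxF⟩ := h _ hpos
  exact absurd ((isMinOn_iff.1 hmin) x hxF) (not_le.2 hx)

/-! ## 3. Windows to levels -/

/-- **No strictly negative window ⇒ a non-melting point on every positive level.** If on every
visited spectral window `{c < λ₁ < c'}` with `c ≥ 0` some point has `μ(S v; S w) ≥ 0` (for a
universal design and `w = Δv` this is the staged K51's `exists_nonexact_of_dirTopEig_neg_on_window`
read contrapositively), then on every attained level `{λ₁ = λ₁(x₁)}` with `λ₁(x₁) > 0` some point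
has `μ ≥ 0`. [ours] -/
theorem exists_level_point_dirTopEig_nonneg (hv : Torus.IsSmooth v) (hw : Torus.IsSmooth w)
    (hW : ∀ c c' : ℝ, 0 ≤ c →
      (∃ x, c < torusStrainTopEig v x ∧ torusStrainTopEig v x < c') →
        ∃ x, c < torusStrainTopEig v x ∧ torusStrainTopEig v x < c' ∧
          0 ≤ dirTopEig (StrainL4.strainFlat v x) (StrainL4.strainFlat w x))
    {x₁ : UnitAddTorus d} (hx₁ : 0 < torusStrainTopEig v x₁) :
    ∃ x, torusStrainTopEig v x = torusStrainTopEig v x₁ ∧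
      0 ≤ dirTopEig (StrainL4.strainFlat v x) (StrainL4.strainFlat w x) := by
  refine exists_level_eq_of_forall_near (continuous_torusStrainTopEig hv)
    (upperSemicontinuous_dirTopEig_strainFlat hv hw) fun δ hδ => ?_
  have hm : 0 < min δ (torusStrainTopEig v x₁) := lt_min hδ hx₁
  have hm1 : min δ (torusStrainTopEig v x₁) ≤ δ := min_le_left _ _
  have hm2 : min δ (torusStrainTopEig v x₁) ≤ torusStrainTopEig v x₁ := min_le_right _ _
  obtain ⟨x, h1, h2, h3⟩ := hW (torusStrainTopEig v x₁ - min δ (torusStrainTopEig v x₁))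
    (torusStrainTopEig v x₁ + min δ (torusStrainTopEig v x₁)) (by linarith)
    ⟨x₁, by linarith, by linarith⟩
  exact ⟨x, abs_sub_lt_iff.2 ⟨by linarith, by linarith⟩, h3⟩

/-- **No strictly positive window ⇒ on every positive level a point whose min-convention mass is
`≤ 0`**, i.e. `0 ≤ μ(S v; −S w)`: some top eigenvector `e` of `S(v)(x)` has `eᵀ S(w)(x) e ≤ 0`
(for a universal design and `w = Δv` the hypothesis is K51's
`exists_nonexact_of_dirTopEig_pos_on_window` read contrapositively). [ours] -/
theorem exists_level_point_dirTopEig_neg_nonneg (hv : Torus.IsSmooth v) (hw : Torus.IsSmooth w)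
    (hW : ∀ c c' : ℝ, 0 ≤ c →
      (∃ x, c < torusStrainTopEig v x ∧ torusStrainTopEig v x < c') →
        ∃ x, c < torusStrainTopEig v x ∧ torusStrainTopEig v x < c' ∧
          dirTopEig (StrainL4.strainFlat v x) (StrainL4.strainFlat w x) ≤ 0)
    {x₁ : UnitAddTorus d} (hx₁ : 0 < torusStrainTopEig v x₁) :
    ∃ x, torusStrainTopEig v x = torusStrainTopEig v x₁ ∧
      0 ≤ dirTopEig (StrainL4.strainFlat v x) (-StrainL4.strainFlat w x) := by
  refine exists_level_eq_of_forall_near (continuous_torusStrainTopEig hv)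
    (upperSemicontinuous_dirTopEig_strainFlat_neg hv hw) fun δ hδ => ?_
  have hm : 0 < min δ (torusStrainTopEig v x₁) := lt_min hδ hx₁
  have hm1 : min δ (torusStrainTopEig v x₁) ≤ δ := min_le_left _ _
  have hm2 : min δ (torusStrainTopEig v x₁) ≤ torusStrainTopEig v x₁ := min_le_right _ _
  obtain ⟨x, h1, h2, h3⟩ := hW (torusStrainTopEig v x₁ - min δ (torusStrainTopEig v x₁))
    (torusStrainTopEig v x₁ + min δ (torusStrainTopEig v x₁)) (by linarith)
    ⟨x₁, by linarith, by linarith⟩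
  refine ⟨x, abs_sub_lt_iff.2 ⟨by linarith, by linarith⟩, ?_⟩
  linarith [dirTopEig_add_dirTopEig_neg_nonneg (StrainL4.strainFlat v x) (StrainL4.strainFlat w x)]

/-- **At the top level**: under the no-negative-window hypothesis a smooth design with `λ₁ ≢ 0`
has a GLOBAL MAXIMISER `x⋆` of `λ₁` with `μ(S v; S w)(x⋆) ≥ 0`. [ours] -/
theorem exists_argmax_dirTopEig_nonneg (hv : Torus.IsSmooth v) (hw : Torus.IsSmooth w)
    (hW : ∀ c c' : ℝ, 0 ≤ c →
      (∃ x, c < torusStrainTopEig v x ∧ torusStrainTopEig v x < c') →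
        ∃ x, c < torusStrainTopEig v x ∧ torusStrainTopEig v x < c' ∧
          0 ≤ dirTopEig (StrainL4.strainFlat v x) (StrainL4.strainFlat w x))
    (hpos : ∃ x, 0 < torusStrainTopEig v x) :
    ∃ x, IsMaxOn (torusStrainTopEig v) univ x ∧
      0 ≤ dirTopEig (StrainL4.strainFlat v x) (StrainL4.strainFlat w x) := by
  obtain ⟨xM, -, hxM⟩ := isCompact_univ.exists_isMaxOn univ_nonempty
    (continuous_torusStrainTopEig hv).continuousOn
  obtain ⟨x₀, hx₀⟩ := hpos
  have hMpos : 0 < torusStrainTopEig v xM :=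
    lt_of_lt_of_le hx₀ ((isMaxOn_iff.1 hxM) x₀ (mem_univ _))
  obtain ⟨x, hx, hμ⟩ := exists_level_point_dirTopEig_nonneg hv hw hW hMpos
  refine ⟨x, isMaxOn_iff.2 fun y hy => ?_, hμ⟩
  rw [hx]
  exact (isMaxOn_iff.1 hxM) y hy

/-- Mirror at the top level: under the no-positive-window hypothesis some global maximiser `x⋆` of
`λ₁` has `μ(S v; −S w)(x⋆) ≥ 0` (a top eigenvector `e` with `eᵀ S(w)(x⋆) e ≤ 0`). [ours] -/
theorem exists_argmax_dirTopEig_neg_nonneg (hv : Torus.IsSmooth v) (hw : Torus.IsSmooth w)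
    (hW : ∀ c c' : ℝ, 0 ≤ c →
      (∃ x, c < torusStrainTopEig v x ∧ torusStrainTopEig v x < c') →
        ∃ x, c < torusStrainTopEig v x ∧ torusStrainTopEig v x < c' ∧
          dirTopEig (StrainL4.strainFlat v x) (StrainL4.strainFlat w x) ≤ 0)
    (hpos : ∃ x, 0 < torusStrainTopEig v x) :
    ∃ x, IsMaxOn (torusStrainTopEig v) univ x ∧
      0 ≤ dirTopEig (StrainL4.strainFlat v x) (-StrainL4.strainFlat w x) := by
  obtain ⟨xM, -, hxM⟩ := isCompact_univ.exists_isMaxOn univ_nonempty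
    (continuous_torusStrainTopEig hv).continuousOn
  obtain ⟨x₀, hx₀⟩ := hpos
  have hMpos : 0 < torusStrainTopEig v xM :=
    lt_of_lt_of_le hx₀ ((isMaxOn_iff.1 hxM) x₀ (mem_univ _))
  obtain ⟨x, hx, hμ⟩ := exists_level_point_dirTopEig_neg_nonneg hv hw hW hMpos
  refine ⟨x, isMaxOn_iff.2 fun y hy => ?_, hμ⟩
  rw [hx]
  exact (isMaxOn_iff.1 hxM) y hy

/-- **`T³`: no strictly positive window ⇒ on every positive level a point with `μ ≤ 0` OR an
eigenvalue crossing `λ₂ = λ₁`.** (At a simple point the min- and max-convention masses agree.)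
[ours] -/
theorem exists_level_point_nonpos_or_crossing
    {u z : UnitAddTorus (Fin 3) → EuclideanSpace ℝ (Fin 3)} (hu : Torus.IsSmooth u)
    (hz : Torus.IsSmooth z)
    (hW : ∀ c c' : ℝ, 0 ≤ c →
      (∃ x, c < torusStrainTopEig u x ∧ torusStrainTopEig u x < c') →
        ∃ x, c < torusStrainTopEig u x ∧ torusStrainTopEig u x < c' ∧
          dirTopEig (StrainL4.strainFlat u x) (StrainL4.strainFlat z x) ≤ 0)
    {x₁ : UnitAddTorus (Fin 3)} (hx₁ : 0 < torusStrainTopEig u x₁) :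
    ∃ x, torusStrainTopEig u x = torusStrainTopEig u x₁ ∧
      (dirTopEig (StrainL4.strainFlat u x) (StrainL4.strainFlat z x) ≤ 0 ∨
        torusStrainTopEig u x ≤ torusStrainMidEig u x) := by
  obtain ⟨x, hx, hμ⟩ := exists_level_point_dirTopEig_neg_nonneg hu hz hW hx₁
  refine ⟨x, hx, ?_⟩
  by_cases hs : torusStrainMidEig u x < torusStrainTopEig u x
  · left
    rw [dirTopEig_strainFlat_neg_of_midEig_lt hs] at hμ
    linarith
  · exact Or.inr (not_lt.1 hs)

/-- **`T³`, top level**: no strictly positive window ⇒ some global maximiser `x⋆` of `λ₁` has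
`μ(x⋆) ≤ 0` or is a crossing point `λ₂(x⋆) = λ₁(x⋆)`. [ours] -/
theorem exists_argmax_nonpos_or_crossing
    {u z : UnitAddTorus (Fin 3) → EuclideanSpace ℝ (Fin 3)} (hu : Torus.IsSmooth u)
    (hz : Torus.IsSmooth z)
    (hW : ∀ c c' : ℝ, 0 ≤ c →
      (∃ x, c < torusStrainTopEig u x ∧ torusStrainTopEig u x < c') →
        ∃ x, c < torusStrainTopEig u x ∧ torusStrainTopEig u x < c' ∧
          dirTopEig (StrainL4.strainFlat u x) (StrainL4.strainFlat z x) ≤ 0)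
    (hpos : ∃ x, 0 < torusStrainTopEig u x) :
    ∃ x, IsMaxOn (torusStrainTopEig u) univ x ∧
      (dirTopEig (StrainL4.strainFlat u x) (StrainL4.strainFlat z x) ≤ 0 ∨
        torusStrainTopEig u x ≤ torusStrainMidEig u x) := by
  obtain ⟨x, hx, hμ⟩ := exists_argmax_dirTopEig_neg_nonneg hu hz hW hpos
  refine ⟨x, hx, ?_⟩
  by_cases hs : torusStrainMidEig u x < torusStrainTopEig u x
  · left
    rw [dirTopEig_strainFlat_neg_of_midEig_lt hs] at hμ
    linarith
  · exact Or.inr (not_lt.1 hs)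

/-! ## 4. Heat: a top that does not melt -/

/-- The heat line through the top strain eigenvalue at a point: `t ↦ λ₁(v + tΔv)(x)` has right
derivative `μ(S v; S Δv)(x)` at `t = 0` (Danskin, via `S(v + tΔv) = S v + t S(Δv)`). [ours] -/
theorem hasDerivWithinAt_topEig_heatLine (hv : Torus.IsSmooth v) (x : UnitAddTorus d) :
    HasDerivWithinAt (fun t : ℝ => torusStrainTopEig (v + t • Torus.laplacian v) x)
      (dirTopEig (StrainL4.strainFlat v x) (StrainL4.strainFlat (Torus.laplacian v) x))
      (Set.Ioi 0) 0 := by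
  have hfun : (fun t : ℝ => torusStrainTopEig (v + t • Torus.laplacian v) x) = fun t : ℝ =>
      lam (StrainL4.strainFlat v x + t • StrainL4.strainFlat (Torus.laplacian v) x) := by
    funext t
    rw [← lam_strainFlat, strainFlat_add_smul (hv.isContDiff (by simp))
      (hv.laplacian.isContDiff (by simp))]
  rw [hfun]
  exact hasDerivWithinAt_lam_line _ _

/-- **FROZEN TOP.** If no visited spectral window `{c < λ₁ < c'}`, `c ≥ 0`, carries a strictly
negative heat Danskin mass `μ(S v; S Δv)` throughout (K51: true for every universal design), then a
smooth design with `λ₁ ≢ 0` has a global maximiser `x⋆` of `λ₁` at which the right derivative of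
`t ↦ λ₁(v + tΔv)(x⋆)` at `t = 0` is `μ(x⋆) ≥ 0`: to first order the heat flow does not lower the
top strain eigenvalue at that maximum. [ours] -/
theorem exists_frozen_top_of_noNegWindow (hv : Torus.IsSmooth v)
    (hW : ∀ c c' : ℝ, 0 ≤ c →
      (∃ x, c < torusStrainTopEig v x ∧ torusStrainTopEig v x < c') →
        ∃ x, c < torusStrainTopEig v x ∧ torusStrainTopEig v x < c' ∧
          0 ≤ dirTopEig (StrainL4.strainFlat v x) (StrainL4.strainFlat (Torus.laplacian v) x))
    (hpos : ∃ x, 0 < torusStrainTopEig v x) :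
    ∃ x, IsMaxOn (torusStrainTopEig v) univ x ∧
      0 ≤ dirTopEig (StrainL4.strainFlat v x) (StrainL4.strainFlat (Torus.laplacian v) x) ∧
      HasDerivWithinAt (fun t : ℝ => torusStrainTopEig (v + t • Torus.laplacian v) x)
        (dirTopEig (StrainL4.strainFlat v x) (StrainL4.strainFlat (Torus.laplacian v) x))
        (Set.Ioi 0) 0 := by
  obtain ⟨x, hx, hμ⟩ := exists_argmax_dirTopEig_nonneg hv hv.laplacian hW hpos
  exact ⟨x, hx, hμ, hasDerivWithinAt_topEig_heatLine hv x⟩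

/-- **Both windows ⇒ on every positive level a non-melting point and a non-growing point (min
convention).** For a universal design (both K51 window theorems apply) every attained positive
level of `λ₁` carries a point with `μ(S v; S Δv) ≥ 0` and a point with `μ(S v; −S Δv) ≥ 0`.
[ours] -/
theorem level_points_of_noSignedWindow (hv : Torus.IsSmooth v)
    (hWn : ∀ c c' : ℝ, 0 ≤ c →
      (∃ x, c < torusStrainTopEig v x ∧ torusStrainTopEig v x < c') →
        ∃ x, c < torusStrainTopEig v x ∧ torusStrainTopEig v x < c' ∧
          0 ≤ dirTopEig (StrainL4.strainFlat v x) (StrainL4.strainFlat (Torus.laplacian v) x))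
    (hWp : ∀ c c' : ℝ, 0 ≤ c →
      (∃ x, c < torusStrainTopEig v x ∧ torusStrainTopEig v x < c') →
        ∃ x, c < torusStrainTopEig v x ∧ torusStrainTopEig v x < c' ∧
          dirTopEig (StrainL4.strainFlat v x) (StrainL4.strainFlat (Torus.laplacian v) x) ≤ 0)
    {x₁ : UnitAddTorus d} (hx₁ : 0 < torusStrainTopEig v x₁) :
    (∃ x, torusStrainTopEig v x = torusStrainTopEig v x₁ ∧
      0 ≤ dirTopEig (StrainL4.strainFlat v x) (StrainL4.strainFlat (Torus.laplacian v) x)) ∧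
    ∃ x, torusStrainTopEig v x = torusStrainTopEig v x₁ ∧
      0 ≤ dirTopEig (StrainL4.strainFlat v x) (-StrainL4.strainFlat (Torus.laplacian v) x) :=
  ⟨exists_level_point_dirTopEig_nonneg hv hv.laplacian hWn hx₁,
    exists_level_point_dirTopEig_neg_nonneg hv hv.laplacian hWp hx₁⟩

end TopEig

end Summit.NavierStokesRegularity.FunctionalMining

end

-- search for candidate a priori estimates; no regularity claim
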